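import Mathlib.RingTheory.Localization.AtPrime.Basic
import Mathlib.RingTheory.Localization.Ideal
import Mathlib.RingTheory.Ideal.IsPrimary
import Mathlib.RingTheory.Ideal.Maps
import Mathlib.RingTheory.LocalRing.MaximalIdeal.Basic
import Mathlib.Tactic.LinearCombination
import Mathlib.Tactic.Ring
import HarnessLib

/-!
# NRA-A run reading, FILE 2a: **from «order ≥ d modulo x at the local ring of the centre» to «g ∈ 𝔮^d» — localisation, primary contraction,
# transport along the chart isomorphism** (pure commutative algebra; Theses-free, def-free)

OURS (campaign `res-hironaka`, rung L ★L-G4, slot W4.1 · crux `Steer` (stmt-ResolutionOfSingularities-16345) · hARᵒ H2, residue word NRA-A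
`NonRationalWindow.NonRationalAWindowTwoN` (res-L0-w41-strat-2 g4); RULING 284(b)(3); plan `D/res-D-repro-2/NRA-A-RUNREADING-PLAN.md` step (3), FILE 2;
seat res-D-repro-2 g9). Not a statement of the manuscript under review [claim: Hironaka2017, status: under-review]; AI-produced, weaker than expert review.

THE SITUATION (abstracted): `B` a ring (the `x`-chart `S[𝔪/x]`), `𝔔 ⊂ B` a prime (the centre of the valuation), `S'` the localisation of `B` at `𝔔`
(the next member `R (j+1)`), `x, F ∈ B` (the exceptional parameter and the weak transform); the PARITY lemma at `S'` gave `F − x·q² ∈ 𝔪_{S'}^d` for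
some `q ∈ S'`.

* `exists_mul_eq_mul_add_of_sub_mul_sq_mem_pow` — clearing denominators: `c·F = x·b + y` with `c ∉ 𝔔`, `y ∈ 𝔔^d`.
* `mem_pow_map_of_mul_eq` — modulo `x` (any ring map `π` killing `x`): if `π(𝔔)`-generated ideal `𝔔̄` is MAXIMAL, then `π F ∈ 𝔔̄^d`
  (`𝔔̄^d` is `𝔔̄`-primary and `π c ∉ 𝔔̄`).
* `symm_mem_comap_pow` — transport to the polynomial side along a ring isomorphism `ψ : A ≃ B̄`: `ψ⁻¹ F̄ ∈ (𝔔̄.comap ψ)^d`.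
[folklore]
-/

set_option linter.dupNamespace false

open IsLocalRing

namespace Summit.ResolutionOfSingularities.ResolutionOfSingularities.Theorems.SwitchingDichotomy.NonRationalWindow

/-- **Clearing denominators.** `B → S'` the localisation at the prime `𝔔`, `F − x q² ∈ 𝔪_{S'}^d` for some `q ∈ S'` ⟹ `c·F = x·b + y` in `B` with
`c ∉ 𝔔` and `y ∈ 𝔔^d`. [folklore] -/
theorem exists_mul_eq_mul_add_of_sub_mul_sq_mem_pow {B S' : Type*} [CommRing B] [CommRing S'] [Algebra B S'] (𝔔 : Ideal B) [𝔔.IsPrime]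
    [IsLocalization.AtPrime S' 𝔔] [IsLocalRing S'] (x F : B) (d : ℕ)
    (h : ∃ q : S', algebraMap B S' F - algebraMap B S' x * q ^ 2 ∈ maximalIdeal S' ^ d) :
    ∃ c b y : B, c ∉ 𝔔 ∧ y ∈ 𝔔 ^ d ∧ c * F = x * b + y := by
  obtain ⟨q, hq⟩ := h
  -- `q = b₀ / t`
  obtain ⟨⟨b₀, t⟩, hqt⟩ := IsLocalization.surj 𝔔.primeCompl q
  -- hqt : q * algebraMap t = algebraMap b₀
  have hmax : maximalIdeal S' = 𝔔.map (algebraMap B S') := (IsLocalization.AtPrime.map_eq_maximalIdeal 𝔔 S').symm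
  have hmem : algebraMap B S' ((t : B) ^ 2 * F - x * b₀ ^ 2) ∈ (𝔔 ^ d).map (algebraMap B S') := by
    rw [Ideal.map_pow, ← hmax]
    have e1 : algebraMap B S' ((t : B) ^ 2 * F - x * b₀ ^ 2) =
        (algebraMap B S' (t : B)) ^ 2 * (algebraMap B S' F - algebraMap B S' x * q ^ 2) := by
      simp only [map_sub, map_mul, map_pow]
      have : algebraMap B S' b₀ = q * algebraMap B S' (t : B) := hqt.symm
      rw [this]; ring
    rw [e1]
    exact Ideal.mul_mem_left _ _ hq
  obtain ⟨⟨⟨y, hy⟩, ⟨t', ht'⟩⟩, hyt⟩ := (IsLocalization.mem_map_algebraMap_iff 𝔔.primeCompl S').mp hmem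
  -- hyt : algebraMap (t² F − x b₀²) * algebraMap t' = algebraMap y
  have hyt' : algebraMap B S' (((t : B) ^ 2 * F - x * b₀ ^ 2) * t') = algebraMap B S' y := by
    rw [map_mul]; exact hyt
  obtain ⟨⟨t'', ht''⟩, heq⟩ := (IsLocalization.eq_iff_exists 𝔔.primeCompl S').mp hyt'
  -- heq : t'' * ((t²F − x b₀²) * t') = t'' * y
  simp only at heq
  refine ⟨t'' * (t' * (t : B) ^ 2), t'' * t' * b₀ ^ 2, t'' * y, ?_, Ideal.mul_mem_left _ _ hy, ?_⟩
  · intro hmem'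
    rcases (‹𝔔.IsPrime›.mem_or_mem hmem') with h1 | h1
    · exact ht'' h1
    · rcases (‹𝔔.IsPrime›.mem_or_mem h1) with h2 | h2
      · exact ht' h2
      · exact t.2 (‹𝔔.IsPrime›.mem_of_pow_mem 2 h2)
  · linear_combination heq

/-- **Modulo `x`, primary contraction.** `π : B → B̄` a ring map with `π x = 0` and `𝔔̄ := 𝔔.map π` MAXIMAL with `𝔔̄.comap π = 𝔔`
(e.g. `ker π = (x) ⊆ 𝔔`); then `c·F = x·b + y` with `c ∉ 𝔔`, `y ∈ 𝔔^d` gives `π F ∈ 𝔔̄^d` (`𝔔̄^d` is `𝔔̄`-primary, `π c ∉ 𝔔̄`). [folklore] -/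
theorem mem_pow_map_of_mul_eq {B C : Type*} [CommRing B] [CommRing C] (π : B →+* C) (𝔔 : Ideal B) {x F c b y : B} {d : ℕ}
    (hπx : π x = 0) (hmax : (𝔔.map π).IsMaximal) (hcomap : (𝔔.map π).comap π = 𝔔)
    (hc : c ∉ 𝔔) (hy : y ∈ 𝔔 ^ d) (heq : c * F = x * b + y) :
    π F ∈ 𝔔.map π ^ d := by
  by_cases hd : d = 0
  · subst hd; simp
  have hprim : (𝔔.map π ^ d).IsPrimary :=
    Ideal.isPrimary_of_isMaximal_radical (by rw [Ideal.radical_pow _ hd, hmax.isPrime.radical]; exact hmax)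
  have hmem : π c * π F ∈ 𝔔.map π ^ d := by
    rw [← map_mul, heq, map_add, map_mul, hπx, zero_mul, zero_add, ← Ideal.map_pow]
    exact Ideal.mem_map_of_mem _ hy
  rcases (Ideal.isPrimary_iff.mp hprim).2 (by rw [mul_comm] at hmem; exact hmem) with h1 | h1
  · exact h1
  · exfalso
    rw [Ideal.radical_pow _ hd, hmax.isPrime.radical, ← Ideal.mem_comap, hcomap] at h1
    exact hc h1

/-- **Transport along a ring isomorphism.** `ψ : A ≃+* C`, `F̄ ∈ J^d` in `C` ⟹ `ψ⁻¹ F̄ ∈ (J.comap ψ)^d`. [folklore] -/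
theorem symm_mem_comap_pow {A C : Type*} [CommRing A] [CommRing C] (ψ : A ≃+* C) (J : Ideal C) {d : ℕ} {G : C} (hG : G ∈ J ^ d) :
    ψ.symm G ∈ (J.comap ψ) ^ d := by
  rw [← Ideal.map_symm, ← Ideal.map_pow]
  exact Ideal.mem_map_of_mem _ hG

end Summit.ResolutionOfSingularities.ResolutionOfSingularities.Theorems.SwitchingDichotomy.NonRationalWindow
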